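import Summits.BirchSwinnertonDyer.BirchSwinnertonDyer.Theses.EisensteinPrimes
import Summits.BirchSwinnertonDyer.Rank1Residual.X1.KellerYinMuLambdaSplit
import Summits.BirchSwinnertonDyer.Rank1Residual.X1.KellerYinIMC2HalvesPub
import Summits.BirchSwinnertonDyer.BirchSwinnertonDyer.Theorems.EisensteinPrimesGoodLatticeMuLambdaDictionary
import Summits.BirchSwinnertonDyer.BirchSwinnertonDyer.Theorems.EisensteinPrimesGoodLatticeQuotCharUnramified
import Summits.BirchSwinnertonDyer.BirchSwinnertonDyer.Theorems.EisensteinPrimesGoodLatticeHeckeCharOfTeichmuller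
import Summits.BirchSwinnertonDyer.BirchSwinnertonDyer.Theorems.EisensteinPrimesGoodLatticeQuotCharUnramifiedAtP
import Literature.NumberTheory.EllipticCurves.HeegnerPointsKolyvaginConjugation
import Literature.NumberTheory.EllipticCurves.Rank1Residual.GVParityTwistProofs
import Literature.NumberTheory.EllipticCurves.GaloisActionProofs
import Literature.NumberTheory.EllipticCurves.ModularityVersionApProofs
import HarnessLib

/-!
# Route `EisensteinPrimes` (rung K5), crux 2 `GoodLatticeBDPValue`, line `halves`: the stub
# `stub_muLambda` COMPOSED in the kernel from its three printed links — `[ALG] + [AN] + [BRω] + [BR𝟙]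
# (+ the published input [F1b]) ⟹ ∀ W p, GoodLatticeMuLambdaOnTree W p`

Cell `bsd-eis` (FULL-BSD rank-≤1 programme, `run/shared/lean/pub/bsd-eis/`), seat `bsd-eis-k5-c2`
(D-0074 group (C) row A). The links: [ALG] = `KellerYin2024.thm151_algmain_goodLattice_OPEN`
(Keller–Yin Thm. 1.5.1 — PREPRINT) and [AN] = `KellerYin2024.thm222_anacong_goodLattice_OPEN` (CGLS
Thm. 2.2.2 with (2.16) / KY Thm. 2.2.2 — PUBLISHED off the trivial character) are the typer seat's
Literature statements (p421326); [BRω], [BR𝟙] (the one-variable character main conjectures at the two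
Teichmüller characters of `G_ℚ` — PREPRINT at the anomalous characters, KY Thm. 1.2.2 / proof of Thm.
2.2.3) and [F1b] (the Katz `p`-adic `L`-function of `θ_K` exists: CGLS Thm. 2.1.2 = Katz /
Hida–Tilouine / Kriz — PUBLISHED, displayed) are the shapes of `X1/KellerYinMuLambdaSplit.lean`
(p428309), whose fourth shape [LOCp] (`𝟙̃` unramified at `p`) is DISCHARGED here
(`goodLatticeQuotCharUnramifiedAtPOnTree_holds`, from the kernel theorem of
`EisensteinPrimesGoodLatticeQuotCharUnramifiedAtP`). This file PROVES that together they give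
the registered stub of the line `halves` (`∀ W p, X1.KellerYinHalves.GoodLatticeMuLambdaOnTree W p`:
`μ = 0` and `λ(𝔛_E) = λ(𝓛_E)` coefficientwise), i.e. Keller–Yin's assembly at arXiv:2402.12781v2
L1631–1640 in the kernel:

* the Teichmüller characters `ω̃`, `𝟙̃ : G_ℚ → GL₁(ℤ_p)` of the lattice are CONSTRUCTED over `ℚ` (a
  rational `p`-line `Φ` from `Red` — `Rank1Residual.exists_isRationalLine_of_not_irr` — and the tree's
  `KellerYin2024.teichmullerLiftOnQuot` on `Φ` and on `E[p]/Φ`), and their RESTRICTIONS to `Γ_K`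
  (`FramedGaloisRep.restrictField K`) are shown to be the residual pair of `E[p](K̄)` over `K`
  (`isTeichmullerLiftOnQuot_restrictField`: transport along the tree's `Γ_K`-equivariant
  `RatClosure.pointsEquiv : E(ℚ̄) ≃ E(K̄)`; `IsResidualPairOver (W/K) p ω̃|_K 𝟙̃|_K`);
* `𝟙̃` is unramified away from `N`: at `ℓ ∤ Np` by the tree THEOREM
  `isUnramifiedAt_of_isTeichmullerLiftOnQuot` (Néron–Ogg–Shafarevich, p425660), at `p` by the tree
  THEOREM `isUnramifiedAt_quotChar_of_anom` (étale quotient at an ordinary prime: the kernel line of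
  reduction is the ramified rational line);
* the Hecke character `θ_K` of `𝟙̃|_K` EXISTS by the tree THEOREM
  `exists_heckeCharacter_of_pow_eq_one` (Artin reciprocity, p427155); [F1b] supplies its Katz frame
  `L₁`; [BR𝟙] gives `μ(𝔛_𝟙̃) = 0`, `λ(𝔛_𝟙̃) = λ(L₁) + [𝟙̃|_K = 𝟙]`; [BRω] gives `μ(𝔛_ω̃) = 0`,
  `λ(𝔛_ω̃) = λ(L₁)`; [ALG] gives `μ(𝔛) = 0`, `λ(𝔛) + [𝟙̃|_K = 𝟙] + Σ_w λ(𝒫_w(f)) = λ(𝔛_ω̃) + λ(𝔛_𝟙̃) +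
  Σ_w (…)`; [AN] gives `μ(L) = 0`, `λ(L) + Σ_w λ(𝒫_w(f)) = 2λ(L₁) + Σ_w (…)`; hence `λ(𝔛) = λ(L)` (the
  local sums CANCEL, as in CGLS Thm. 2.2.3) — `KellerYin2024.lambda_eq_of_alg_of_an_of_bridge`;
* the Weierstrass dictionary (`EisensteinPrimesMuLambda.firstUnitCoeff_map_toUnr_of_charIdeal_eq_span`,
  p417976) turns `μ(𝔛) = 0 ∧ λ(𝔛) = λ(L)` into the stub's coefficientwise conclusion for every
  generator `F` of `char_Λ(𝔛)`.

CONDITIONAL on the five named inputs (hypotheses BY NAME; nothing booked; no label moves). Helper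
attached to stmt-BirchSwinnertonDyer-19032 (`--supports`).
-/

set_option autoImplicit false
set_option linter.dupNamespace false

noncomputable section

open scoped Classical

open PowerSeries WeierstrassCurve NumberField IsDedekindDomain Field Rat.HeightOneSpectrum
  Literature.NumberTheory.EllipticCurves Literature.NumberTheory.EllipticCurves.ModularForms
  Literature.NumberTheory.QuadraticFields Literature.NumberTheory.EllipticCurves.Rank1Residual
  Literature.NumberTheory.EllipticCurves.Castella2018
  Literature.NumberTheory.EllipticCurves.CastellaGrossiLeeSkinner2022
  Literature.NumberTheory.EllipticCurves.KellerYin2024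
  Literature.NumberTheory.EllipticCurves.GreenbergVatsal2000
  Literature.NumberTheory.GaloisRepresentations
  Summit.BirchSwinnertonDyer.Rank1Residual.X11b.Halves
  Summit.BirchSwinnertonDyer.Rank1Residual.X1.KellerYinHalves
  Summit.BirchSwinnertonDyer.Rank1Residual.X1.KellerYinMuLambdaSplit

namespace Summit.BirchSwinnertonDyer.BirchSwinnertonDyer.Theorems.EisensteinPrimesMuLambda

/-! ## §1 The Teichmüller characters of the lattice over `ℚ` EXIST (a construction) -/

section CharData

variable (W : WeierstrassCurve ℚ) [W.IsElliptic] (p : ℕ) [hp : Fact p.Prime]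

/-- **The Teichmüller pair `(ω̃, 𝟙̃)` of `G_ℚ` exists**: for `E/ℚ` with `E[p]` reducible there are a
rational `p`-line `Φ ≤ E[p](ℚ̄)` and the Teichmüller lifts `θsub = ω̃`, `θquot = 𝟙̃ : G_ℚ → GL₁(ℤ_p)`
of the characters of `G_ℚ` on `Φ` and on `E[p]/Φ` (`KellerYin2024.teichmullerLiftOnQuot`; `E[p](ℚ̄)`
has order `p²` and open point stabilisers — tree theorems `card_torsionPoints_eq_sq_holds`,
`isOpen_stabilizer_point_holds`). [cite: KellerYin2024, §1.4 (arXiv:2402.12781v2 TeX L1063–1086)] -/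
theorem exists_teichmullerPair (hred : Red W p) :
    ∃ Φ : AddSubgroup (geomTorsion W (p : ℤ)), IsRationalLine W p Φ ∧
      ∃ (θsub θquot : FramedGaloisRep ℚ (padicCoeffIntegers (∅ : Set (PadicAlgCl p))) 1),
        IsTeichmullerLiftOn (∅ : Set (PadicAlgCl p)) (Φ.map (geomTorsion W (p : ℤ)).subtype) θsub ∧
        IsTeichmullerLiftOnQuot (∅ : Set (PadicAlgCl p)) (Φ.map (geomTorsion W (p : ℤ)).subtype)
          (geomTorsion W (p : ℤ)) θquot := by
  obtain ⟨Φ, hcard, hstab⟩ := exists_isRationalLine_of_not_irr (W := W) (p := p) hred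
  have hp0 : p ≠ 0 := hp.out.ne_zero
  -- stability of `T = E[p]`, `N = Φ` (read in `E(ℚ̄)`) and `⊥`
  have hTstab : ∀ σ : absoluteGaloisGroup ℚ, ∀ P ∈ geomTorsion W (p : ℤ), σ • P ∈ geomTorsion W (p : ℤ) :=
    fun σ P hP ↦ by
    rw [mem_geomTorsion_iff] at hP ⊢
    rw [smul_comm, hP, smul_zero]
  have hNstab : ∀ σ : absoluteGaloisGroup ℚ, ∀ P ∈ Φ.map (geomTorsion W (p : ℤ)).subtype,
      σ • P ∈ Φ.map (geomTorsion W (p : ℤ)).subtype := by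
    rintro σ _ ⟨P, hPmem, rfl⟩
    exact ⟨σ • P, hstab σ P hPmem, rfl⟩
  have hbot : ∀ σ : absoluteGaloisGroup ℚ, ∀ P ∈ (⊥ : AddSubgroup (geomPoints W)),
      σ • P ∈ (⊥ : AddSubgroup (geomPoints W)) := fun σ P hP ↦ by
    rw [AddSubgroup.mem_bot] at hP ⊢; rw [hP, smul_zero]
  -- finiteness and open stabilisers
  have hTcard : Nat.card (geomTorsion W (p : ℤ)) = p ^ 2 :=
    card_torsionPoints_eq_sq_holds W (AlgebraicClosure ℚ) (n := p) (by exact_mod_cast hp0)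
  have hTfin : (geomTorsion W (p : ℤ) : Set (geomPoints W)).Finite := by
    have : Finite (geomTorsion W (p : ℤ)) := Nat.finite_of_card_ne_zero (by rw [hTcard]; positivity)
    exact Set.toFinite _
  have hle : Φ.map (geomTorsion W (p : ℤ)).subtype ≤ geomTorsion W (p : ℤ) := by
    rintro _ ⟨P, _, rfl⟩
    exact P.2
  have hNfin : (Φ.map (geomTorsion W (p : ℤ)).subtype : Set (geomPoints W)).Finite := hTfin.subset hle
  have hstabT : ∀ P ∈ geomTorsion W (p : ℤ),
      IsOpen ((MulAction.stabilizer (absoluteGaloisGroup ℚ) P : Subgroup _) : Set (absoluteGaloisGroup ℚ)) :=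
    fun P _ ↦ isOpen_stabilizer_point_holds W P
  have hstabN : ∀ P ∈ Φ.map (geomTorsion W (p : ℤ)).subtype,
      IsOpen ((MulAction.stabilizer (absoluteGaloisGroup ℚ) P : Subgroup _) : Set (absoluteGaloisGroup ℚ)) :=
    fun P hP ↦ hstabT P (hle hP)
  -- indices
  have hNcard : Nat.card (Φ.map (geomTorsion W (p : ℤ)).subtype) = p := by
    rw [Nat.card_congr (Φ.equivMapOfInjective (geomTorsion W (p : ℤ)).subtype
      (geomTorsion W (p : ℤ)).subtype_injective).toEquiv.symm, hcard]
  have hidx1 : (⊥ : AddSubgroup (geomPoints W)).relIndex (Φ.map (geomTorsion W (p : ℤ)).subtype) = p := by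
    rw [AddSubgroup.relIndex_bot_left, hNcard]
  have hidx2 : (Φ.map (geomTorsion W (p : ℤ)).subtype).relIndex (geomTorsion W (p : ℤ)) = p := by
    have h := AddSubgroup.relIndex_mul_relIndex (⊥ : AddSubgroup (geomPoints W))
      (Φ.map (geomTorsion W (p : ℤ)).subtype) (geomTorsion W (p : ℤ)) bot_le hle
    rw [hidx1, AddSubgroup.relIndex_bot_left, hTcard, sq] at h
    exact Nat.eq_of_mul_eq_mul_left hp.out.pos h
  exact ⟨Φ, ⟨hcard, hstab⟩, teichmullerLiftOnQuot ∅ hbot hNstab hidx1 hNfin hstabN,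
    teichmullerLiftOnQuot ∅ hNstab hTstab hidx2 hTfin hstabT,
    isTeichmullerLiftOnQuot_teichmullerLiftOnQuot ∅ hbot hNstab hidx1 hNfin hstabN,
    isTeichmullerLiftOnQuot_teichmullerLiftOnQuot ∅ hNstab hTstab hidx2 hTfin hstabT⟩

variable (K : Type) [Field K] [NumberField K]

omit [W.IsElliptic] in
/-- **Transport of the Teichmüller predicate along `E(ℚ̄) ≃ E(K̄)`**: if `θ : G_ℚ → GL₁(𝓞)` is the
Teichmüller lift of the action of `G_ℚ` on `T/N` (`N, T ≤ E(ℚ̄)`), then its restriction `θ|_{G_K}`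
(`FramedGaloisRep.restrictField K θ`) is the Teichmüller lift of the action of `Γ_K` on
`e(T)/e(N)`, `e = RatClosure.pointsEquiv` (equivariant along `absGaloisRestrict ℚ K`:
`pointsEquiv_smul`). [cite: KellerYin2024, §1.4 (arXiv:2402.12781v2 TeX L1063–1086)] -/
theorem isTeichmullerLiftOnQuot_restrictField {S : Set (PadicAlgCl p)}
    {N T : AddSubgroup (geomPoints W)} {θ : FramedGaloisRep ℚ (padicCoeffIntegers S) 1}
    (hθ : IsTeichmullerLiftOnQuot S N T θ) :
    IsTeichmullerLiftOnQuot S (N.map (RatClosure.pointsEquiv (K := K) W).toAddMonoidHom)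
      (T.map (RatClosure.pointsEquiv (K := K) W).toAddMonoidHom) (θ.restrictField K) := by
  refine ⟨fun σ ↦ ?_, fun σ ↦ ?_⟩
  · rw [FramedGaloisRep.restrictField_apply]
    exact hθ.1 _
  · obtain ⟨a, ha, hmem⟩ := hθ.2 (absGaloisRestrict ℚ K σ)
    refine ⟨a, ha, ?_⟩
    rintro _ ⟨P, hP, rfl⟩
    refine ⟨absGaloisRestrict ℚ K σ • P - a • P, hmem P hP, ?_⟩
    rw [AddEquiv.coe_toAddMonoidHom, map_sub, map_zsmul, RatClosure.pointsEquiv_smul]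

omit [W.IsElliptic] in
/-- `e(E[n](ℚ̄)) = E[n](K̄)` for `e = RatClosure.pointsEquiv`. [folklore] -/
theorem map_pointsEquiv_geomTorsion (n : ℤ) :
    (geomTorsion W n).map (RatClosure.pointsEquiv (K := K) W).toAddMonoidHom =
      geomTorsion (W.baseChange K) n := by
  ext Q
  constructor
  · rintro ⟨P, hP, rfl⟩
    rw [mem_geomTorsion_iff, AddEquiv.coe_toAddMonoidHom, ← map_zsmul, (mem_geomTorsion_iff W _ _).mp hP,
      map_zero]
  · intro hQ
    refine ⟨(RatClosure.pointsEquiv (K := K) W).symm Q, ?_, by simp⟩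
    rw [SetLike.mem_coe, mem_geomTorsion_iff, ← map_zsmul, (mem_geomTorsion_iff _ _ _).mp hQ, map_zero]

omit [W.IsElliptic] in
/-- **The restricted pair is the residual pair over `K`.** For a rational `p`-line `Φ` and the
Teichmüller characters `θsub`, `θquot` of `G_ℚ` on `Φ` and `E[p]/Φ`, the restrictions `θsub|_{G_K}`,
`θquot|_{G_K}` form a residual pair of `E[p](K̄)` over `K` (`KellerYin2024.IsResidualPairOver`, on the
`Γ_K`-stable line `e(Φ)` of order `p`). [cite: KellerYin2024, §1.4 (arXiv:2402.12781v2 TeX L1063–1086)] -/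
theorem isResidualPairOver_restrictField {Φ : AddSubgroup (geomTorsion W (p : ℤ))}
    (hΦ : IsRationalLine W p Φ)
    {θsub θquot : FramedGaloisRep ℚ (padicCoeffIntegers (∅ : Set (PadicAlgCl p))) 1}
    (hsub : IsTeichmullerLiftOn (∅ : Set (PadicAlgCl p)) (Φ.map (geomTorsion W (p : ℤ)).subtype) θsub)
    (hquot : IsTeichmullerLiftOnQuot (∅ : Set (PadicAlgCl p)) (Φ.map (geomTorsion W (p : ℤ)).subtype)
      (geomTorsion W (p : ℤ)) θquot) :
    IsResidualPairOver (W.baseChange K) p (θsub.restrictField K) (θquot.restrictField K) := by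
  obtain ⟨hcard, hstab⟩ := hΦ
  let e : geomPoints W ≃+ geomPoints (W.baseChange K) := RatClosure.pointsEquiv (K := K) W
  let Φ₁ : AddSubgroup (geomPoints W) := Φ.map (geomTorsion W (p : ℤ)).subtype
  have hK := isTeichmullerLiftOnQuot_restrictField W p K hquot
  have hKsub := isTeichmullerLiftOnQuot_restrictField W p K hsub
  rw [map_pointsEquiv_geomTorsion] at hK
  rw [AddSubgroup.map_bot] at hKsub
  refine isResidualPairOver_of_isTeichmullerLift (Φ := Φ₁.map e.toAddMonoidHom) ?_ ?_ ?_ hKsub hK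
  · -- cardinality
    rw [← hcard, ← Nat.card_congr (Φ₁.equivMapOfInjective e.toAddMonoidHom e.injective).toEquiv,
      ← Nat.card_congr (Φ.equivMapOfInjective (geomTorsion W (p : ℤ)).subtype
        (geomTorsion W (p : ℤ)).subtype_injective).toEquiv]
  · -- `p`-torsion
    rintro _ ⟨Q, ⟨P, hPmem, rfl⟩, rfl⟩
    rw [mem_geomTorsion_iff, AddEquiv.coe_toAddMonoidHom, ← map_zsmul, AddSubgroup.coe_subtype,
      (mem_geomTorsion_iff W _ _).mp P.2, map_zero]
  · -- `Γ_K`-stability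
    rintro σ _ ⟨Q, ⟨P, hPmem, rfl⟩, rfl⟩
    refine ⟨absGaloisRestrict ℚ K σ • ((P : geomTorsion W (p : ℤ)) : geomPoints W),
      ⟨absGaloisRestrict ℚ K σ • P, hstab _ P hPmem, rfl⟩, ?_⟩
    rw [AddEquiv.coe_toAddMonoidHom, AddSubgroup.coe_subtype]
    exact RatClosure.pointsEquiv_smul W σ _

end CharData

/-! ## §2 Places: the bad set `S` over `K`, and good reduction over `ℚ` away from `N` -/

section BadSet

variable {K : Type} [Field K] [NumberField K]

/-- The finite set of places of `K` dividing a non-zero natural number `N`. [folklore] -/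
theorem exists_finset_places_dvd {N : ℕ} (hN : N ≠ 0) :
    ∃ S : Finset (HeightOneSpectrum (𝓞 K)), ∀ w, w ∈ S ↔ ((N : ℤ) : 𝓞 K) ∈ w.asIdeal := by
  have hI : (Ideal.span {((N : ℤ) : 𝓞 K)} : Ideal (𝓞 K)) ≠ 0 := by
    rw [Ne, Ideal.zero_eq_bot, Ideal.span_singleton_eq_bot]
    exact_mod_cast hN
  refine ⟨(Ideal.finite_factors hI).toFinset, fun w ↦ ?_⟩
  rw [Set.Finite.mem_toFinset, Set.mem_setOf_eq, Ideal.dvd_span_singleton]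

/-- **Good reduction of `W/ℚ` at a place `u ∤ N_W`** (the prime `ℓ` under `u` does not divide the
conductor; `dvd_conductorNorm_iff_not_hasGoodReductionAtPrime`). [folklore] -/
theorem hasGoodReductionAt_of_conductorNorm_notMem (W : WeierstrassCurve ℚ) [W.IsElliptic]
    (u : HeightOneSpectrum (𝓞 ℚ)) (hu : ((W.conductorNorm ℤ : ℤ) : 𝓞 ℚ) ∉ u.asIdeal) :
    W.HasGoodReductionAt u := by
  haveI := Fact.mk (primesEquiv u).2
  have hℓu : ((primesEquiv u : ℕ) : 𝓞 ℚ) ∈ u.asIdeal :=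
    (natCast_mem_asIdeal_iff_eq_primesEquiv_symm u (primesEquiv u).2).mpr
      (by rw [Subtype.coe_eta, Equiv.symm_apply_apply])
  have hℓN : ¬ (primesEquiv u : ℕ) ∣ W.conductorNorm ℤ := by
    rintro ⟨c, hc⟩
    apply hu
    rw [hc]; push_cast
    exact u.asIdeal.mul_mem_right _ hℓu
  have hgood : W.HasGoodReductionAtPrime (primesEquiv u) := by
    by_contra h
    exact hℓN ((W.dvd_conductorNorm_iff_not_hasGoodReductionAtPrime (primesEquiv u)).mpr h)
  exact (W.hasGoodReductionAtPrime_iff_hasGoodReductionAt_ringOfIntegers u).mp hgood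

end BadSet

/-! ## §3 [LOCp] discharged -/

section LocP

/-- **The displayed input [LOCp] HOLDS**: `𝟙̃` is unramified at `p` for the good lattice at a good
anomalous prime (the kernel theorem `isUnramifiedAt_quotChar_of_anom` of
`EisensteinPrimesGoodLatticeQuotCharUnramifiedAtP`, with the binders of
`X1.KellerYinMuLambdaSplit.GoodLatticeQuotCharUnramifiedAtPOnTree`). [cite: KellerYin2024, Prop. 1.3.1 and §1.4 (arXiv:2402.12781v2 TeX L877, L1087)]
[cite: SilvermanAEC2009, VII.§2–3] -/
theorem goodLatticeQuotCharUnramifiedAtPOnTree_holds (W : WeierstrassCurve ℚ) [W.IsElliptic]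
    [W.IsGloballyMinimal] (p : ℕ) [Fact p.Prime] : GoodLatticeQuotCharUnramifiedAtPOnTree W p :=
  fun hp hgood hred hanom hGL Φ hΦ θ hθ u hu ↦
    isUnramifiedAt_quotChar_of_anom W p ∅ hp hgood hred hanom hGL Φ hΦ θ hθ u hu

end LocP

/-! ## §4 The composition -/

section Compose

/-- **THE COMPOSITION: the registered stub `stub_muLambda` of the line `halves` from its three printed
links and ONE published displayed input.** `[ALG]` (`thm151_algmain_goodLattice_OPEN`: Keller–Yin Thm.
1.5.1 at the good lattice, PRE) + `[AN]` (`thm222_anacong_goodLattice_OPEN`: CGLS Thm. 2.2.2 with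
(2.16) / KY 2.2.2) + `[BRω]`, `[BR𝟙]` (the one-variable character main conjectures at `ω̃`, `𝟙̃`; PRE
at the anomalous characters) + `[F1b]` (the Katz `p`-adic `L`-function of `θ_K` exists, PUB)
⟹ `∀ W p, X1.KellerYinHalves.GoodLatticeMuLambdaOnTree W p`
(`μ(𝔛) = μ(𝓛) = 0`, `λ(𝔛) = λ(𝓛)`, coefficientwise on every generator of `char_Λ(𝔛)` and every BDP
frame) — Keller–Yin's proof of Thm. 3.0.8 at L1631–1640 ("both `𝔛_f` and `𝓛_f` have vanishing
`μ`-invariants and equal `λ`-invariants (all computed independently)") in the kernel, with the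
characters `ω̃`, `𝟙̃` CONSTRUCTED over `ℚ`, the unramifiedness of `𝟙̃` away from `Np`
(Néron–Ogg–Shafarevich), at `p` (étale quotient) and the existence of `θ_K` (Artin reciprocity)
PROVED. CONDITIONAL on the named inputs; nothing booked. [claim: KellerYin2024, status: under-review]
[cite: KellerYin2024, Thm. 1.5.1, Thm. 1.2.2, Thms. 2.2.1–2.2.3, proof of Thm. 3.0.8 (arXiv:2402.12781v2 TeX L1631–1640)]
[cite: CastellaGrossiLeeSkinner2022, Thm. 2.2.1–2.2.3, Thm. 2.1.2] -/
theorem goodLatticeMuLambdaOnTree_of_split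
    (halg : thm151_algmain_goodLattice_OPEN) (han : thm222_anacong_goodLattice_OPEN)
    (hω : ∀ (W : WeierstrassCurve ℚ) [W.IsElliptic] [W.IsGloballyMinimal] (p : ℕ) [Fact p.Prime],
      GoodLatticeOmegaSideOnTree W p)
    (hbr : ∀ (p : ℕ) [Fact p.Prime], CharMainConjOnTree p)
    (hF1 : ∀ (p : ℕ) [Fact p.Prime], KatzLFunctionExistsFor p)
    (W : WeierstrassCurve ℚ) [W.IsElliptic] [W.IsGloballyMinimal] (p : ℕ) [Fact p.Prime] :
    GoodLatticeMuLambdaOnTree W p := by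
  intro hp hgood hred hanom hGL K _ _ hK hHN hHp hodd h3 hEK hSel ι v vbar hv hvbar hne κ hκ γ hγ N _ Dt
    H ιC P hP ι' hι' ΩK Ωp L hΩK hL F hF
  -- §1: the Teichmüller pair over `ℚ`, its restriction to `K`, the bad set
  obtain ⟨Φ, hΦ, θsub, θquot, hsub, hquot⟩ := exists_teichmullerPair W p hred
  have hpair : IsResidualPairOver (W.baseChange K) p (θsub.restrictField K) (θquot.restrictField K) :=
    isResidualPairOver_restrictField W p K hΦ hsub hquot
  obtain ⟨Sf, hSf⟩ := exists_finset_places_dvd (K := K) (N := W.conductorNorm ℤ)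
    (W.conductorNorm_pos_holds).ne'
  -- §2: `𝟙̃` is Teichmüller, unramified away from `N` (Néron–Ogg–Shafarevich + [LOCp]) and at `p`
  have hT1 : ∀ σ : absoluteGaloisGroup ℚ, θquot σ ^ (p - 1) = 1 := hquot.1
  have hT1K : ∀ σ : absoluteGaloisGroup K, θquot.restrictField K σ ^ (p - 1) = 1 := fun σ ↦ hT1 _
  have hpN : ¬ p ∣ W.conductorNorm ℤ := fun h ↦
    (W.dvd_conductorNorm_iff_not_hasGoodReductionAtPrime p).mp h hgood
  have hcardΦ : Nat.card (Φ.map (geomTorsion W (p : ℤ)).subtype) = p := by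
    rw [Nat.card_congr (Φ.equivMapOfInjective (geomTorsion W (p : ℤ)).subtype
      (geomTorsion W (p : ℤ)).subtype_injective).toEquiv.symm, hΦ.1]
  have hunrp : ∀ u : HeightOneSpectrum (𝓞 ℚ), ((p : ℕ) : 𝓞 ℚ) ∈ u.asIdeal → θquot.IsUnramifiedAt u :=
    goodLatticeQuotCharUnramifiedAtPOnTree_holds W p hp hgood hred hanom hGL Φ hΦ θquot hquot
  have hunr : ∀ u : HeightOneSpectrum (𝓞 ℚ), ((W.conductorNorm ℤ : ℤ) : 𝓞 ℚ) ∉ u.asIdeal →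
      θquot.IsUnramifiedAt u := by
    intro u hu
    by_cases hpu : ((p : ℕ) : 𝓞 ℚ) ∈ u.asIdeal
    · exact hunrp u hpu
    · exact isUnramifiedAt_of_isTeichmullerLiftOnQuot W ∅ hcardΦ hquot
        (hasGoodReductionAt_of_conductorNorm_notMem W u hu) hpu
  -- §3: the Hecke character `θ_K` of `𝟙̃|_K` (Artin reciprocity) and its Katz frame ([F1b])
  obtain ⟨θK, -, hθK'⟩ := exists_heckeCharacter_of_pow_eq_one ∅ ι' (θquot.restrictField K) hT1K
  have hθK : IsHeckeCharOf ι' (θquot.restrictField K) θK := hθK'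
  obtain ⟨ΩK₁, Ωp₁, L₁, hΩK₁, hL₁⟩ :=
    hF1 p hp K hK hHp hodd h3 ι v vbar hv hvbar hne κ hκ γ ι' hι' θquot hT1 (W.conductorNorm ℤ) hHN hunr
      hunrp θK hθK
  have hCbar : ∀ u ∈ (∅ : Finset (HeightOneSpectrum (𝓞 K))), ¬ θK.IsUnramifiedAt u := by simp
  -- §4: the dual data of the two character Selmer groups (exist unconditionally, p414770)
  obtain ⟨Dsub⟩ := nonempty_unrDualData_char (∅ : Set (PadicAlgCl p)) (θsub.restrictField K) κ vbar
    (∅ : Set (HeightOneSpectrum (𝓞 K))) hγ.out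
  obtain ⟨Dquot⟩ := nonempty_unrDualData_char (∅ : Set (PadicAlgCl p)) (θquot.restrictField K) κ vbar
    (∅ : Set (HeightOneSpectrum (𝓞 K))) hγ.out
  -- §5: [BR𝟙] at `𝟙̃`
  obtain ⟨-, -, -, m₁, hm₁, hlam1⟩ := hbr p hp K hK hHp hodd h3 ι v vbar hv hvbar hne κ hκ γ ι'
    hι' θquot hT1 (W.conductorNorm ℤ) hHN hunr hunrp θK hθK Dquot ∅ hCbar ΩK₁ Ωp₁ L₁ hΩK₁ hL₁
  -- §6: [BRω] at `ω̃`
  obtain ⟨-, -, -, hlamω⟩ := hω W p hp hgood hred hanom hGL K hK hHN hHp hodd h3 hEK ι v vbar hv hvbar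
    hne κ hκ γ ι' hι' Φ hΦ θsub θquot hsub hquot θK hθK ∅ hCbar ΩK₁ Ωp₁ L₁ hΩK₁ hL₁ m₁ hm₁ Dsub
  -- §7: [ALG]
  obtain ⟨hXfin, hXtors, hXmu, hXlam⟩ := halg W p hp hgood hred hanom hGL K hK hHN hHp hEK ι v vbar hv
    hvbar hne κ hκ γ (θsub.restrictField K) (θquot.restrictField K) hpair Sf hSf Dsub Dquot
  -- §8: [AN]
  obtain ⟨m, m₁', hm, hm₁', hman⟩ := han W p hp hgood hred hanom hGL K hK hHN hHp hodd h3 hEK ι v vbar hv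
    hvbar hne κ hκ γ N Dt ι' hι' ΩK Ωp L hΩK hL (θsub.restrictField K) (θquot.restrictField K) hpair Sf
    hSf θK hθK ∅ hCbar ΩK₁ Ωp₁ L₁ hΩK₁ hL₁
  have hmm : m₁' = m₁ := hm₁'.unique hm₁
  subst hmm
  -- §9: bookkeeping: `λ(𝔛) = m` (the local sums cancel)
  have hlamX : lambdaInvariant p (AcSelmer.XAc (W.baseChange K) p κ vbar ∅ γ) = m :=
    lambda_eq_of_alg_of_an_of_bridge hXlam hman hlamω hlam1
  -- §10: the Weierstrass dictionary on the generator `F`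
  haveI := hXfin
  have hFU := firstUnitCoeff_map_toUnr_of_charIdeal_eq_span
    (AcSelmer.XAc (W.baseChange K) p κ vbar ∅ γ) hXtors hXmu (F := F) hF
  rw [hlamX] at hFU
  exact ⟨m, hFU, (firstUnitCoeffAt_iff L m).mp hm⟩

/-- **The crux BY NAME from the PUBLISHED named inputs and three PREPRINT statements about
characters.** `GoodLatticeBDPValue` (= `h308`, Keller–Yin Thm. 3.0.8 at the good lattice read at `𝟙`)
follows from: Castella–Hsieh 2018 Def. 3.7/Prop. 3.8 (BDP frame exists), Carayol (level = conductor),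
CGLS 2022 proof of Thm. 4.2.2 first half (one divisibility), CGLS 2022 Thm. 5.1.3 (BDP value) — the
four fact-grade stubs of the line `halves` (`KellerYinHalves.thm308_of_cgls_of_muLambda`, p411059) —,
[F1b] (CGLS Thm. 2.1.2: the Katz `p`-adic `L`-function exists) and [AN] off the trivial character
(PUBLISHED), together with [ALG], [BRω], [BR𝟙] (Keller–Yin's new content at an anomalous prime,
PREPRINT); everything else (the characters, their unramifiedness, `θ_K`) is constructed / proved. CONDITIONAL; nothing booked; no label
moves. [claim: KellerYin2024, status: under-review]
[cite: KellerYin2024, Thm. 3.0.8 (IMC2), Thm. 1.5.1, Thm. 1.2.2, Thms. 2.2.1–2.2.3]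
[cite: CastellaGrossiLeeSkinner2022, proof of Thm. 4.2.2, Thm. 5.1.3, Thm. 2.1.2, Thm. 2.2.1–2.2.2]
[cite: CastellaHsieh2018, Def. 3.7 and Prop. 3.8] -/
theorem goodLatticeBDPValue_of_published_of_split
    (hCH : castellaHsieh2018_exists_isBDPLFunction)
    (hC : ∀ (N : ℕ) [NeZero N], IsNewformOf.level_eq_conductorNorm (N := N))
    (hdiv : proofThm422_exists_isBDPLFunction_isTorsion_charIdeal_dvd)
    (hval : thm513_exists_isBDPLFunction_valueAtOne)
    (halg : thm151_algmain_goodLattice_OPEN) (han : thm222_anacong_goodLattice_OPEN)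
    (hω : ∀ (W : WeierstrassCurve ℚ) [W.IsElliptic] [W.IsGloballyMinimal] (p : ℕ) [Fact p.Prime],
      GoodLatticeOmegaSideOnTree W p)
    (hbr : ∀ (p : ℕ) [Fact p.Prime], CharMainConjOnTree p)
    (hF1 : ∀ (p : ℕ) [Fact p.Prime], KatzLFunctionExistsFor p) :
    Summit.BirchSwinnertonDyer.BirchSwinnertonDyer.Theses.EisensteinPrimes.GoodLatticeBDPValue := by
  unfold Summit.BirchSwinnertonDyer.BirchSwinnertonDyer.Theses.EisensteinPrimes.GoodLatticeBDPValue
  exact thm308_of_cgls_of_muLambda hCH hC hdiv hval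
    (fun W _ _ p _ ↦ goodLatticeMuLambdaOnTree_of_split halg han hω hbr hF1 W p)

end Compose

end Summit.BirchSwinnertonDyer.BirchSwinnertonDyer.Theorems.EisensteinPrimesMuLambda

end
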